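import Summits.Ventures.YMGap.Thresholds.WilsonHessian
import Mathlib.Analysis.SpecialFunctions.Pow.Real
import HarnessLib

/-!
# Route `ColdStartUniversality` (fixed-cut-off package, Bakry–Émery side, WEIGHTED gradient bounds): the single-plaquette
# WEIGHTED polarisation bound for the second-order word of the Wilson action

Helper file (seat `ym-line-csu-p1`, g43; `--supports stmt-QuantumFields-24809`).  Pure matrix algebra behind the weighted frame
Hessian bound of the sequel `…WeightedHessian` (the hypothesis `hHess` of `generator_wcarre_sub_ge_of_whessBound`).  With the venture's
second-order word `word2 V₁ B₁ … V₄ B₄` (twice the `t²`-coefficient of `Re tr(e^(tV₁)B₁⋯e^(tV₄)B₄)`, `SinglePlaquetteSOS`) and the squared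
Frobenius norm `frobSq`:
* `pair_weight_bound` — the scalar AM–GM step with a RATIO constraint: if `0 < cᵢ ≤ b²cⱼ`, `0 < cⱼ ≤ b²cᵢ` and `2|o| ≤ t²F + G/t²` for all
  `t > 0`, then `(cᵢ + cⱼ)|o| ≤ ((b²+1)/(2b))·(cᵢF + cⱼG)` (the constant `(√a + 1/√a)/2` of a weight of ratio `a = b²`);
* `two_mul_abs_re_trace_four_le` (`2|Re tr(XMYM')| ≤ t²‖X‖² + ‖Y‖²/t²` for unitary `M, M'`),
  `abs_re_trace_sq_mul_le` (`|Re tr(XXW)| ≤ ‖X‖²`);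
* `word2_real_smul` — `word2` is a quadratic form in real scalings of its four slots (explicit coefficients);
* ★★ `abs_word2_wcross_le` — for unitary `B`'s, arbitrary `V`'s, and positive slot weights `c` of pairwise ratio `≤ b²`:
  `|word2((1+c)•V) − word2(V) − word2(c•V)| ≤ 2(1 + 3(b²+1)/(2b))·Σᵢ cᵢ‖Vᵢ‖²` — the polarised (bilinear) plaquette Hessian paired with a
  link weight, the per-plaquette input of Shen–Zhu–Zhu's weighted estimate (CMP 400 (2023) (5.13), constant `(4+4√a)` there).
THEOREMS ONLY, no definition, no sorry; all [folklore].  HONEST FRAMING: finite-dimensional matrix algebra; no statement about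
measures or the Yang–Mills mass gap.
-/

set_option autoImplicit false

noncomputable section

namespace Summit.QuantumFields.YangMills.Theorems.ColdStartUniversality

open Matrix Complex Finset
open scoped Matrix ComplexConjugate BigOperators
open Summit.Ventures.YMGap.HessianSharp (frobSq word2 frobSq_nonneg frobSq_neg frobSq_mul_of_mul_conjTranspose frobSq_mul_of_conjTranspose_mul
  re_trace_mul_mul_le conjTranspose_mul_self_of_mem mul_conjTranspose_self_of_mem)

/-! ## §1. The scalar AM–GM step with a ratio constraint -/

/-- **AM–GM with a ratio constraint.**  If `0 < cᵢ ≤ b²·cⱼ`, `0 < cⱼ ≤ b²·cᵢ` (`b ≥ 1`), `F, G ≥ 0` and `2|o| ≤ t²F + G/t²` for every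
`t > 0`, then `(cᵢ + cⱼ)·|o| ≤ ((b²+1)/(2b))·(cᵢF + cⱼG)`. [folklore] -/
theorem pair_weight_bound {ci cj b F G o : ℝ} (hb : 1 ≤ b) (hci : 0 < ci) (hcj : 0 < cj) (h1 : ci ≤ b ^ 2 * cj)
    (h2 : cj ≤ b ^ 2 * ci) (hG : 0 ≤ G) (ho : ∀ t : ℝ, 0 < t → 2 * |o| ≤ t ^ 2 * F + G / t ^ 2) :
    (ci + cj) * |o| ≤ (b ^ 2 + 1) / (2 * b) * (ci * F + cj * G) := by
  have hb0 : 0 < b := lt_of_lt_of_le one_pos hb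
  set θ : ℝ := (b ^ 2 + 1) / (2 * b) with hθ
  have hθ0 : 0 < θ := by rw [hθ]; positivity
  have hsum : 0 < ci + cj := add_pos hci hcj
  -- the optimal parameter `t² = 2θcᵢ/(cᵢ+cⱼ)`
  set τ : ℝ := 2 * θ * ci / (ci + cj) with hτ
  have hτ0 : 0 < τ := by rw [hτ]; positivity
  have h := ho (Real.sqrt τ) (Real.sqrt_pos.2 hτ0)
  rw [Real.sq_sqrt hτ0.le] at h
  -- `(cᵢ+cⱼ)τ/2 = θcᵢ` and `(cᵢ+cⱼ)/(2τ) ≤ θcⱼ`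
  have e1 : (ci + cj) * τ / 2 = θ * ci := by
    rw [hτ]; field_simp
  have hdisc : (ci + cj) ^ 2 ≤ 4 * θ ^ 2 * (ci * cj) := by
    have hθ2 : 4 * θ ^ 2 = (b ^ 2 + 1) ^ 2 / b ^ 2 := by rw [hθ]; field_simp; ring
    rw [hθ2, div_mul_eq_mul_div, le_div_iff₀ (by positivity)]
    nlinarith [mul_nonneg (sub_nonneg.2 h1) (sub_nonneg.2 h2)]
  have e2 : (ci + cj) / (2 * τ) ≤ θ * cj := by
    rw [hτ, div_le_iff₀ (by positivity)]
    have : (ci + cj) * (ci + cj) ≤ θ * cj * (2 * (2 * θ * ci)) := by nlinarith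
    calc ci + cj = (ci + cj) * (ci + cj) / (ci + cj) := by field_simp
      _ ≤ θ * cj * (2 * (2 * θ * ci)) / (ci + cj) := by gcongr
      _ = θ * cj * (2 * (2 * θ * ci / (ci + cj))) := by field_simp
  have hF : 0 ≤ F := by
    -- from `ho` with large `t`: `0 ≤ 2|o| ≤ t²F + G/t²`; if `F < 0` this fails for `t` large
    by_contra hF
    push Not at hF
    obtain ⟨t, ht1, ht2⟩ : ∃ t : ℝ, 1 ≤ t ∧ (G + 1) / (-F) < t ^ 2 := by
      refine ⟨max 1 ((G + 1) / (-F) + 1), le_max_left _ _, ?_⟩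
      have hm : (G + 1) / (-F) + 1 ≤ max 1 ((G + 1) / (-F) + 1) := le_max_right _ _
      have hpos : 0 < (G + 1) / (-F) := div_pos (by linarith) (by linarith)
      nlinarith
    have h' := ho t (by linarith)
    have hG' : G / t ^ 2 ≤ G := div_le_self hG (by nlinarith)
    have hneg : t ^ 2 * F < -(G + 1) := by
      have := (div_lt_iff₀ (show 0 < -F by linarith)).1 ht2
      nlinarith
    linarith [abs_nonneg o]
  calc (ci + cj) * |o| = (ci + cj) / 2 * (2 * |o|) := by ring
    _ ≤ (ci + cj) / 2 * (τ * F + G / τ) := by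
        refine mul_le_mul_of_nonneg_left ?_ (by positivity)
        simpa [mul_comm] using h
    _ = (ci + cj) * τ / 2 * F + (ci + cj) / (2 * τ) * G := by field_simp
    _ ≤ θ * ci * F + θ * cj * G := by
        rw [e1]
        exact add_le_add le_rfl (mul_le_mul_of_nonneg_right e2 hG)
    _ = θ * (ci * F + cj * G) := by ring

/-! ## §2. Matrix inequalities -/

section MatrixFacts

variable {n : Type*} [Fintype n] [DecidableEq n]

omit [DecidableEq n] in
/-- `‖(r:ℂ)•A‖² = r²‖A‖²` for a real scalar (local copy of the tree's `frobSq_real_smul`, to keep imports light). [folklore] -/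
private theorem frobSq_real_smul' (r : ℝ) (A : Matrix n n ℂ) : frobSq ((r : ℂ) • A) = r ^ 2 * frobSq A := by
  unfold frobSq
  rw [conjTranspose_smul, Matrix.smul_mul, Matrix.mul_smul, smul_smul, trace_smul, smul_eq_mul, Complex.star_def,
    Complex.conj_ofReal, ← Complex.ofReal_mul, Complex.re_ofReal_mul]
  ring

/-- `|Re tr(X X W)| ≤ ‖X‖²` for `W Wᴴ = 1`. [folklore] -/
theorem abs_re_trace_sq_mul_le (X W : Matrix n n ℂ) (hW : W * Wᴴ = 1) : |(X * X * W).trace.re| ≤ frobSq X := by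
  rw [abs_le]
  constructor
  · have h := re_trace_mul_mul_le (-X) X W hW
    rw [frobSq_neg, Matrix.neg_mul, Matrix.neg_mul, trace_neg, Complex.neg_re] at h
    linarith
  · have h := re_trace_mul_mul_le X X W hW
    linarith

/-- `2|Re tr(X M Y M')| ≤ t²‖X‖² + ‖Y‖²/t²` for `Mᴴ M = 1`, `M' M'ᴴ = 1` and every `t > 0` (the square
`0 ≤ ‖(tX)ᴴ − M(Y/t)M'‖²`). [folklore] -/
theorem two_mul_abs_re_trace_four_le (X M Y M' : Matrix n n ℂ) (hM : Mᴴ * M = 1) (hM' : M' * M'ᴴ = 1) {t : ℝ} (ht : 0 < t) :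
    2 * |(X * M * Y * M').trace.re| ≤ t ^ 2 * frobSq X + frobSq Y / t ^ 2 := by
  have key : ∀ Z : Matrix n n ℂ, 2 * (Z * M * Y * M').trace.re ≤ t ^ 2 * frobSq Z + frobSq Y / t ^ 2 := by
    intro Z
    have e : Z * M * Y * M' = ((t : ℂ) • Z) * (M * ((t⁻¹ : ℝ) : ℂ) • Y) * M' := by
      rw [Matrix.mul_smul, Matrix.smul_mul, Matrix.smul_mul, Matrix.mul_smul, Matrix.smul_mul, smul_smul, ← Complex.ofReal_mul,
        mul_inv_cancel₀ ht.ne', Complex.ofReal_one, one_smul, Matrix.mul_assoc Z M Y]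
    have h := re_trace_mul_mul_le ((t : ℂ) • Z) (M * ((t⁻¹ : ℝ) : ℂ) • Y) M' hM'
    rw [← e, frobSq_real_smul', frobSq_mul_of_conjTranspose_mul _ _ hM, frobSq_real_smul', inv_pow, ← div_eq_inv_mul] at h
    linarith
  have h1 := key X
  have h2 := key (-X)
  rw [frobSq_neg, Matrix.neg_mul, Matrix.neg_mul, Matrix.neg_mul, trace_neg, Complex.neg_re] at h2
  have habs : |(X * M * Y * M').trace.re| ≤ (t ^ 2 * frobSq X + frobSq Y / t ^ 2) / 2 := abs_le.2 ⟨by linarith, by linarith⟩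
  linarith

/-! ## §3. `word2` as a quadratic form in real scalings of its slots -/

omit [DecidableEq n] in
/-- **`word2` under real scalings of its four slots**: with the ten trace coefficients of `word2` at `(V₁,…,V₄)`,
`word2((l₁V₁),B₁,…,(l₄V₄),B₄) = Σᵢ lᵢ²·dᵢ + 2 Σ_(i<j) lᵢlⱼ·oᵢⱼ`. [folklore] -/
theorem word2_real_smul (l₁ l₂ l₃ l₄ : ℝ) (V₁ B₁ V₂ B₂ V₃ B₃ V₄ B₄ : Matrix n n ℂ) :
    word2 ((l₁ : ℂ) • V₁) B₁ ((l₂ : ℂ) • V₂) B₂ ((l₃ : ℂ) • V₃) B₃ ((l₄ : ℂ) • V₄) B₄ =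
      l₁ ^ 2 * (V₁ * V₁ * B₁ * B₂ * B₃ * B₄).trace.re + l₂ ^ 2 * (B₁ * V₂ * V₂ * B₂ * B₃ * B₄).trace.re
        + l₃ ^ 2 * (B₁ * B₂ * V₃ * V₃ * B₃ * B₄).trace.re + l₄ ^ 2 * (B₁ * B₂ * B₃ * V₄ * V₄ * B₄).trace.re
        + 2 * (l₁ * l₂ * (V₁ * B₁ * V₂ * B₂ * B₃ * B₄).trace.re + l₁ * l₃ * (V₁ * B₁ * B₂ * V₃ * B₃ * B₄).trace.re
          + l₁ * l₄ * (V₁ * B₁ * B₂ * B₃ * V₄ * B₄).trace.re + l₂ * l₃ * (B₁ * V₂ * B₂ * V₃ * B₃ * B₄).trace.re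
          + l₂ * l₄ * (B₁ * V₂ * B₂ * B₃ * V₄ * B₄).trace.re + l₃ * l₄ * (B₁ * B₂ * V₃ * B₃ * V₄ * B₄).trace.re) := by
  unfold word2
  simp only [Matrix.smul_mul, Matrix.mul_smul, trace_smul, smul_eq_mul, Complex.add_re, Complex.mul_re,
    Complex.ofReal_re, Complex.ofReal_im, Complex.re_ofNat, Complex.im_ofNat, zero_mul, sub_zero]
  ring

/-! ## §4. The weighted polarisation bound for one plaquette word -/

/-- ★★ **Weighted polarisation bound for the plaquette word.**  For unitary `B₁,…,B₄`, arbitrary `V₁,…,V₄`, `b ≥ 1` and positive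
slot weights `c₁,…,c₄` of pairwise ratio at most `b²`:
`|word2((1+cᵢ)•Vᵢ; B) − word2(V; B) − word2(cᵢ•Vᵢ; B)| ≤ 2·(1 + 3(b²+1)/(2b))·Σᵢ cᵢ‖Vᵢ‖²`
(the cross terms are `2Σᵢ cᵢ dᵢ + 2Σ_(i<j)(cᵢ+cⱼ) oᵢⱼ` with `|dᵢ| ≤ ‖Vᵢ‖²`, `2|oᵢⱼ| ≤ t²‖Vᵢ‖² + ‖Vⱼ‖²/t²`, then `pair_weight_bound`).
[cite: ShenZhuZhuCMP2023, (5.13)] -/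
theorem abs_word2_wcross_le (V₁ B₁ V₂ B₂ V₃ B₃ V₄ B₄ : Matrix n n ℂ)
    (hB₁ : B₁ ∈ Matrix.unitaryGroup n ℂ) (hB₂ : B₂ ∈ Matrix.unitaryGroup n ℂ)
    (hB₃ : B₃ ∈ Matrix.unitaryGroup n ℂ) (hB₄ : B₄ ∈ Matrix.unitaryGroup n ℂ)
    {b c₁ c₂ c₃ c₄ : ℝ} (hb : 1 ≤ b) (hc₁ : 0 < c₁) (hc₂ : 0 < c₂) (hc₃ : 0 < c₃) (hc₄ : 0 < c₄)
    (h12 : c₁ ≤ b ^ 2 * c₂) (h21 : c₂ ≤ b ^ 2 * c₁) (h13 : c₁ ≤ b ^ 2 * c₃) (h31 : c₃ ≤ b ^ 2 * c₁)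
    (h14 : c₁ ≤ b ^ 2 * c₄) (h41 : c₄ ≤ b ^ 2 * c₁) (h23 : c₂ ≤ b ^ 2 * c₃) (h32 : c₃ ≤ b ^ 2 * c₂)
    (h24 : c₂ ≤ b ^ 2 * c₄) (h42 : c₄ ≤ b ^ 2 * c₂) (h34 : c₃ ≤ b ^ 2 * c₄) (h43 : c₄ ≤ b ^ 2 * c₃) :
    |word2 (((1 + c₁ : ℝ) : ℂ) • V₁) B₁ (((1 + c₂ : ℝ) : ℂ) • V₂) B₂ (((1 + c₃ : ℝ) : ℂ) • V₃) B₃ (((1 + c₄ : ℝ) : ℂ) • V₄) B₄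
      - word2 V₁ B₁ V₂ B₂ V₃ B₃ V₄ B₄ - word2 ((c₁ : ℂ) • V₁) B₁ ((c₂ : ℂ) • V₂) B₂ ((c₃ : ℂ) • V₃) B₃ ((c₄ : ℂ) • V₄) B₄|
      ≤ 2 * (1 + 3 * ((b ^ 2 + 1) / (2 * b))) * (c₁ * frobSq V₁ + c₂ * frobSq V₂ + c₃ * frobSq V₃ + c₄ * frobSq V₄) := by
  have u₁ := conjTranspose_mul_self_of_mem hB₁
  have u₂ := conjTranspose_mul_self_of_mem hB₂
  have u₃ := conjTranspose_mul_self_of_mem hB₃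
  have w₄ := mul_conjTranspose_self_of_mem hB₄
  -- names for the ten coefficients
  set d₁ : ℝ := (V₁ * V₁ * B₁ * B₂ * B₃ * B₄).trace.re with hd₁
  set d₂ : ℝ := (B₁ * V₂ * V₂ * B₂ * B₃ * B₄).trace.re with hd₂
  set d₃ : ℝ := (B₁ * B₂ * V₃ * V₃ * B₃ * B₄).trace.re with hd₃
  set d₄ : ℝ := (B₁ * B₂ * B₃ * V₄ * V₄ * B₄).trace.re with hd₄
  set o₁₂ : ℝ := (V₁ * B₁ * V₂ * B₂ * B₃ * B₄).trace.re with ho₁₂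
  set o₁₃ : ℝ := (V₁ * B₁ * B₂ * V₃ * B₃ * B₄).trace.re with ho₁₃
  set o₁₄ : ℝ := (V₁ * B₁ * B₂ * B₃ * V₄ * B₄).trace.re with ho₁₄
  set o₂₃ : ℝ := (B₁ * V₂ * B₂ * V₃ * B₃ * B₄).trace.re with ho₂₃
  set o₂₄ : ℝ := (B₁ * V₂ * B₂ * B₃ * V₄ * B₄).trace.re with ho₂₄
  set o₃₄ : ℝ := (B₁ * B₂ * V₃ * B₃ * V₄ * B₄).trace.re with ho₃₄
  -- the cross term
  have hcross : word2 (((1 + c₁ : ℝ) : ℂ) • V₁) B₁ (((1 + c₂ : ℝ) : ℂ) • V₂) B₂ (((1 + c₃ : ℝ) : ℂ) • V₃) B₃ (((1 + c₄ : ℝ) : ℂ) • V₄) B₄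
      - word2 V₁ B₁ V₂ B₂ V₃ B₃ V₄ B₄ - word2 ((c₁ : ℂ) • V₁) B₁ ((c₂ : ℂ) • V₂) B₂ ((c₃ : ℂ) • V₃) B₃ ((c₄ : ℂ) • V₄) B₄ =
      2 * (c₁ * d₁ + c₂ * d₂ + c₃ * d₃ + c₄ * d₄) + 2 * ((c₁ + c₂) * o₁₂ + (c₁ + c₃) * o₁₃ + (c₁ + c₄) * o₁₄
        + (c₂ + c₃) * o₂₃ + (c₂ + c₄) * o₂₄ + (c₃ + c₄) * o₃₄) := by
    have h1 := word2_real_smul (1 + c₁) (1 + c₂) (1 + c₃) (1 + c₄) V₁ B₁ V₂ B₂ V₃ B₃ V₄ B₄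
    have hc := word2_real_smul c₁ c₂ c₃ c₄ V₁ B₁ V₂ B₂ V₃ B₃ V₄ B₄
    have h0 := word2_real_smul 1 1 1 1 V₁ B₁ V₂ B₂ V₃ B₃ V₄ B₄
    simp only [Complex.ofReal_one, one_smul] at h0
    rw [h1, hc, h0]
    ring
  -- unitarity of partial products
  have m12 := mul_mem hB₁ hB₂
  have m123 := mul_mem m12 hB₃
  have m1234 := mul_mem m123 hB₄
  have m23 := mul_mem hB₂ hB₃
  have m234 := mul_mem m23 hB₄
  have m34 := mul_mem hB₃ hB₄
  have m2341 := mul_mem m234 hB₁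
  have m341 := mul_mem m34 hB₁
  have m3412 := mul_mem m34 m12
  have m41 := mul_mem hB₄ hB₁
  have m4123 := mul_mem hB₄ m123
  have m412 := mul_mem hB₄ m12
  -- diagonal coefficients: `|dᵢ| ≤ ‖Vᵢ‖²` (rotate the unitary factors behind `VᵢVᵢ`)
  have bd₁ : |d₁| ≤ frobSq V₁ := by
    have h := abs_re_trace_sq_mul_le V₁ (B₁ * B₂ * B₃ * B₄) (mul_conjTranspose_self_of_mem m1234)
    rwa [show V₁ * V₁ * (B₁ * B₂ * B₃ * B₄) = V₁ * V₁ * B₁ * B₂ * B₃ * B₄ by simp only [Matrix.mul_assoc]] at h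
  have bd₂ : |d₂| ≤ frobSq V₂ := by
    have h := abs_re_trace_sq_mul_le V₂ (B₂ * B₃ * B₄ * B₁) (mul_conjTranspose_self_of_mem m2341)
    have e : (V₂ * V₂ * (B₂ * B₃ * B₄ * B₁)).trace = (B₁ * V₂ * V₂ * B₂ * B₃ * B₄).trace := by
      rw [show V₂ * V₂ * (B₂ * B₃ * B₄ * B₁) = (V₂ * V₂ * B₂ * B₃ * B₄) * B₁ by simp only [Matrix.mul_assoc], Matrix.trace_mul_comm]
      simp only [Matrix.mul_assoc]
    rwa [e] at h
  have bd₃ : |d₃| ≤ frobSq V₃ := by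
    have h := abs_re_trace_sq_mul_le V₃ (B₃ * B₄ * (B₁ * B₂)) (mul_conjTranspose_self_of_mem m3412)
    have e : (V₃ * V₃ * (B₃ * B₄ * (B₁ * B₂))).trace = (B₁ * B₂ * V₃ * V₃ * B₃ * B₄).trace := by
      rw [show V₃ * V₃ * (B₃ * B₄ * (B₁ * B₂)) = (V₃ * V₃ * B₃ * B₄) * (B₁ * B₂) by simp only [Matrix.mul_assoc], Matrix.trace_mul_comm]
      simp only [Matrix.mul_assoc]
    rwa [e] at h
  have bd₄ : |d₄| ≤ frobSq V₄ := by
    have h := abs_re_trace_sq_mul_le V₄ (B₄ * (B₁ * B₂ * B₃)) (mul_conjTranspose_self_of_mem m4123)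
    have e : (V₄ * V₄ * (B₄ * (B₁ * B₂ * B₃))).trace = (B₁ * B₂ * B₃ * V₄ * V₄ * B₄).trace := by
      rw [show V₄ * V₄ * (B₄ * (B₁ * B₂ * B₃)) = (V₄ * V₄ * B₄) * (B₁ * B₂ * B₃) by simp only [Matrix.mul_assoc], Matrix.trace_mul_comm]
      simp only [Matrix.mul_assoc]
    rwa [e] at h
  -- off-diagonal coefficients: `2|oᵢⱼ| ≤ t²‖Vᵢ‖² + ‖Vⱼ‖²/t²`
  have bo₁₂ : ∀ t : ℝ, 0 < t → 2 * |o₁₂| ≤ t ^ 2 * frobSq V₁ + frobSq V₂ / t ^ 2 := by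
    intro t ht
    have h := two_mul_abs_re_trace_four_le V₁ B₁ V₂ (B₂ * B₃ * B₄) u₁ (mul_conjTranspose_self_of_mem m234) ht
    rwa [show V₁ * B₁ * V₂ * (B₂ * B₃ * B₄) = V₁ * B₁ * V₂ * B₂ * B₃ * B₄ by simp only [Matrix.mul_assoc]] at h
  have bo₁₃ : ∀ t : ℝ, 0 < t → 2 * |o₁₃| ≤ t ^ 2 * frobSq V₁ + frobSq V₃ / t ^ 2 := by
    intro t ht
    have h := two_mul_abs_re_trace_four_le V₁ (B₁ * B₂) V₃ (B₃ * B₄) (conjTranspose_mul_self_of_mem m12) (mul_conjTranspose_self_of_mem m34) ht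
    rwa [show V₁ * (B₁ * B₂) * V₃ * (B₃ * B₄) = V₁ * B₁ * B₂ * V₃ * B₃ * B₄ by simp only [Matrix.mul_assoc]] at h
  have bo₁₄ : ∀ t : ℝ, 0 < t → 2 * |o₁₄| ≤ t ^ 2 * frobSq V₁ + frobSq V₄ / t ^ 2 := by
    intro t ht
    have h := two_mul_abs_re_trace_four_le V₁ (B₁ * B₂ * B₃) V₄ B₄ (conjTranspose_mul_self_of_mem m123) w₄ ht
    rwa [show V₁ * (B₁ * B₂ * B₃) * V₄ * B₄ = V₁ * B₁ * B₂ * B₃ * V₄ * B₄ by simp only [Matrix.mul_assoc]] at h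
  have bo₂₃ : ∀ t : ℝ, 0 < t → 2 * |o₂₃| ≤ t ^ 2 * frobSq V₂ + frobSq V₃ / t ^ 2 := by
    intro t ht
    have h := two_mul_abs_re_trace_four_le V₂ B₂ V₃ (B₃ * B₄ * B₁) u₂ (mul_conjTranspose_self_of_mem m341) ht
    have e : (V₂ * B₂ * V₃ * (B₃ * B₄ * B₁)).trace = (B₁ * V₂ * B₂ * V₃ * B₃ * B₄).trace := by
      rw [show V₂ * B₂ * V₃ * (B₃ * B₄ * B₁) = (V₂ * B₂ * V₃ * B₃ * B₄) * B₁ by simp only [Matrix.mul_assoc], Matrix.trace_mul_comm]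
      simp only [Matrix.mul_assoc]
    rwa [e] at h
  have bo₂₄ : ∀ t : ℝ, 0 < t → 2 * |o₂₄| ≤ t ^ 2 * frobSq V₂ + frobSq V₄ / t ^ 2 := by
    intro t ht
    have h := two_mul_abs_re_trace_four_le V₂ (B₂ * B₃) V₄ (B₄ * B₁) (conjTranspose_mul_self_of_mem m23) (mul_conjTranspose_self_of_mem m41) ht
    have e : (V₂ * (B₂ * B₃) * V₄ * (B₄ * B₁)).trace = (B₁ * V₂ * B₂ * B₃ * V₄ * B₄).trace := by
      rw [show V₂ * (B₂ * B₃) * V₄ * (B₄ * B₁) = (V₂ * B₂ * B₃ * V₄ * B₄) * B₁ by simp only [Matrix.mul_assoc], Matrix.trace_mul_comm]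
      simp only [Matrix.mul_assoc]
    rwa [e] at h
  have bo₃₄ : ∀ t : ℝ, 0 < t → 2 * |o₃₄| ≤ t ^ 2 * frobSq V₃ + frobSq V₄ / t ^ 2 := by
    intro t ht
    have h := two_mul_abs_re_trace_four_le V₃ B₃ V₄ (B₄ * (B₁ * B₂)) u₃ (mul_conjTranspose_self_of_mem m412) ht
    have e : (V₃ * B₃ * V₄ * (B₄ * (B₁ * B₂))).trace = (B₁ * B₂ * V₃ * B₃ * V₄ * B₄).trace := by
      rw [show V₃ * B₃ * V₄ * (B₄ * (B₁ * B₂)) = (V₃ * B₃ * V₄ * B₄) * (B₁ * B₂) by simp only [Matrix.mul_assoc], Matrix.trace_mul_comm]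
      simp only [Matrix.mul_assoc]
    rwa [e] at h
  -- the pair bounds
  have f₁ := frobSq_nonneg V₁
  have f₂ := frobSq_nonneg V₂
  have f₃ := frobSq_nonneg V₃
  have f₄ := frobSq_nonneg V₄
  have p₁₂ := pair_weight_bound hb hc₁ hc₂ h12 h21 f₂ bo₁₂
  have p₁₃ := pair_weight_bound hb hc₁ hc₃ h13 h31 f₃ bo₁₃
  have p₁₄ := pair_weight_bound hb hc₁ hc₄ h14 h41 f₄ bo₁₄
  have p₂₃ := pair_weight_bound hb hc₂ hc₃ h23 h32 f₃ bo₂₃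
  have p₂₄ := pair_weight_bound hb hc₂ hc₄ h24 h42 f₄ bo₂₄
  have p₃₄ := pair_weight_bound hb hc₃ hc₄ h34 h43 f₄ bo₃₄
  set θ : ℝ := (b ^ 2 + 1) / (2 * b) with hθ
  rw [hcross]
  -- termwise absolute values
  have hd : |c₁ * d₁ + c₂ * d₂ + c₃ * d₃ + c₄ * d₄| ≤ c₁ * frobSq V₁ + c₂ * frobSq V₂ + c₃ * frobSq V₃ + c₄ * frobSq V₄ := by
    refine (abs_add_le _ _).trans (add_le_add ((abs_add_le _ _).trans (add_le_add ((abs_add_le _ _).trans (add_le_add ?_ ?_)) ?_)) ?_)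
    · rw [abs_mul, abs_of_pos hc₁]; exact mul_le_mul_of_nonneg_left bd₁ hc₁.le
    · rw [abs_mul, abs_of_pos hc₂]; exact mul_le_mul_of_nonneg_left bd₂ hc₂.le
    · rw [abs_mul, abs_of_pos hc₃]; exact mul_le_mul_of_nonneg_left bd₃ hc₃.le
    · rw [abs_mul, abs_of_pos hc₄]; exact mul_le_mul_of_nonneg_left bd₄ hc₄.le
  have ho : |(c₁ + c₂) * o₁₂ + (c₁ + c₃) * o₁₃ + (c₁ + c₄) * o₁₄ + (c₂ + c₃) * o₂₃ + (c₂ + c₄) * o₂₄ + (c₃ + c₄) * o₃₄| ≤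
      θ * (c₁ * frobSq V₁ + c₂ * frobSq V₂) + θ * (c₁ * frobSq V₁ + c₃ * frobSq V₃) + θ * (c₁ * frobSq V₁ + c₄ * frobSq V₄)
        + θ * (c₂ * frobSq V₂ + c₃ * frobSq V₃) + θ * (c₂ * frobSq V₂ + c₄ * frobSq V₄) + θ * (c₃ * frobSq V₃ + c₄ * frobSq V₄) := by
    have e : ∀ (c o : ℝ), 0 ≤ c → |c * o| = c * |o| := fun c o hc => by rw [abs_mul, abs_of_nonneg hc]
    refine (abs_add_le _ _).trans (add_le_add ((abs_add_le _ _).trans (add_le_add ((abs_add_le _ _).trans (add_le_add ((abs_add_le _ _).trans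
      (add_le_add ((abs_add_le _ _).trans (add_le_add ?_ ?_)) ?_)) ?_)) ?_)) ?_)
    · rw [e _ _ (by linarith)]; exact p₁₂
    · rw [e _ _ (by linarith)]; exact p₁₃
    · rw [e _ _ (by linarith)]; exact p₁₄
    · rw [e _ _ (by linarith)]; exact p₂₃
    · rw [e _ _ (by linarith)]; exact p₂₄
    · rw [e _ _ (by linarith)]; exact p₃₄
  calc |2 * (c₁ * d₁ + c₂ * d₂ + c₃ * d₃ + c₄ * d₄) + 2 * ((c₁ + c₂) * o₁₂ + (c₁ + c₃) * o₁₃ + (c₁ + c₄) * o₁₄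
        + (c₂ + c₃) * o₂₃ + (c₂ + c₄) * o₂₄ + (c₃ + c₄) * o₃₄)|
      ≤ 2 * |c₁ * d₁ + c₂ * d₂ + c₃ * d₃ + c₄ * d₄| + 2 * |(c₁ + c₂) * o₁₂ + (c₁ + c₃) * o₁₃ + (c₁ + c₄) * o₁₄
        + (c₂ + c₃) * o₂₃ + (c₂ + c₄) * o₂₄ + (c₃ + c₄) * o₃₄| := by
        refine (abs_add_le _ _).trans ?_
        rw [abs_mul, abs_mul, show |(2:ℝ)| = 2 by norm_num]
    _ ≤ 2 * (c₁ * frobSq V₁ + c₂ * frobSq V₂ + c₃ * frobSq V₃ + c₄ * frobSq V₄)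
        + 2 * (θ * (c₁ * frobSq V₁ + c₂ * frobSq V₂) + θ * (c₁ * frobSq V₁ + c₃ * frobSq V₃) + θ * (c₁ * frobSq V₁ + c₄ * frobSq V₄)
        + θ * (c₂ * frobSq V₂ + c₃ * frobSq V₃) + θ * (c₂ * frobSq V₂ + c₄ * frobSq V₄) + θ * (c₃ * frobSq V₃ + c₄ * frobSq V₄)) := by
        linarith
    _ = 2 * (1 + 3 * θ) * (c₁ * frobSq V₁ + c₂ * frobSq V₂ + c₃ * frobSq V₃ + c₄ * frobSq V₄) := by ring

end MatrixFacts

end Summit.QuantumFields.YangMills.Theorems.ColdStartUniversality
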